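import Summits.SmoothPoincare4.SmoothPoincare4.Theses.SymplecticOrigami
import Literature.Topology.FourManifolds.DisjunctionLemma

/-!
# Stub `stub_pinch_blowdownQuotient` of line `pair-rigidity-endgame`
# (crux `SymplecticOrigami.OrigamiRung`)

A registered sub-goal of the lead's stub `stub_pinch`: **the blow-down of a closed piece is a
quotient map onto the target, folding the fold onto the exceptional surface.**  Let `β : M → N`
be the blow-down of a piece `V` (open, `M` compact) of the fold decomposition, continuous near
`closure V`, mapping `V` onto `N ∖ B` for the embedded compact surface `B = range b`
(`b : S → N` a smooth embedding) and the fold `frontier V` into `B`.  Then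

* `β '' closure V = N`: `B` has empty interior (a `C¹` image of a compact `2`-manifold in a
  `4`-manifold is nowhere dense, Hirsch Ch. 3 §1 Prop. 1.2, in the chart-wise form
  `dense_compl_image_of_contMDiffOn` of the tree; re-derived here as a private copy of the
  sibling stub file's `interior_range_eq_empty_of_contMDiff`, whose module was not yet built
  when this file landed), so `N ∖ B = β '' V` is dense, while `β '' closure V ⊇ β '' V` is
  compact, hence closed, hence everything;
* `β '' frontier V = B`: `closure V = V ∪ frontier V` and `β '' V = Bᶜ`;
* `β|closure V` is a quotient map: a continuous surjection from a compact space to a Hausdorff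
  space is closed (`Continuous.isClosedMap`), hence a quotient map (`IsClosedMap.isQuotientMap`).

In other words `N` is the adjunction space `closure V ∪_{β|fold} B`.
-/

noncomputable section

-- the prescribed namespace `Summit.<P>.<Sub>.…` duplicates `SmoothPoincare4` (P = Sub)
set_option linter.dupNamespace false

open scoped Manifold ContDiff Topology ContinuousMap
open Set TopologicalSpace
open Literature.Topology.FourManifolds (singularHomologyZ sphereInversion IsTwistedSphere)
open Literature.Geometry.Kaehler (MForm IsSmoothForm IsClosedForm)

namespace Summit.SmoothPoincare4.SmoothPoincare4.Theorems.OrigamiRung.PairRigidityEndgame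

section BlowdownQuotient

open Function Topology

/-! ### Images of lower-dimensional compact manifolds are nowhere dense -/

/-- **The image of a compact `k`-manifold under a smooth map into an `n`-manifold, `k < n`, has
empty interior** (Hirsch, *Differential Topology*, Ch. 3 §1, Prop. 1.2); private copy of the
sibling stub file's `interior_range_eq_empty_of_contMDiff`.  At an interior point `x` of
`range b`, read in the chart `ψ` at `x`: the open set `ψ(interior (range b) ∩ dom ψ)` lies in
the image `(ψ ∘ b)(b⁻¹ dom ψ)` of an open set of `S` under a `C¹` map into `ℝⁿ`, whose
complement is dense (`dense_compl_image_of_contMDiffOn`; a compact manifold is second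
countable).
[cite: HirschDT1976, Ch. 3 §1, Prop. 1.2] -/
private theorem interior_range_eq_empty_aux {k n : ℕ} (hkn : k < n)
    {S : Type*} [TopologicalSpace S] [CompactSpace S] [ChartedSpace (EuclideanSpace ℝ (Fin k)) S]
    [IsManifold (𝓡 k) ∞ S]
    {N : Type*} [TopologicalSpace N] [ChartedSpace (EuclideanSpace ℝ (Fin n)) N]
    [IsManifold (𝓡 n) ∞ N]
    {b : S → N} (hb : ContMDiff (𝓡 k) (𝓡 n) ∞ b) : interior (range b) = ∅ := by
  haveI : SecondCountableTopology S :=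
    ChartedSpace.secondCountable_of_sigmaCompact (EuclideanSpace ℝ (Fin k)) S
  rw [eq_empty_iff_forall_notMem]
  intro x hx
  set ψ := chartAt (EuclideanSpace ℝ (Fin n)) x with hψ
  set W := interior (range b) ∩ ψ.source with hW
  have hWo : IsOpen W := isOpen_interior.inter ψ.open_source
  have hxW : x ∈ W := ⟨hx, mem_chart_source _ x⟩
  set T := b ⁻¹' ψ.source with hT
  have hTo : IsOpen T := ψ.open_source.preimage hb.continuous
  have hf : ContMDiffOn (𝓡 k) 𝓘(ℝ, EuclideanSpace ℝ (Fin n)) 1 (ψ ∘ b) T := by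
    have h1 : ContMDiffOn (𝓡 n) (𝓡 n) 1 ψ ψ.source := contMDiffOn_chart
    exact h1.comp (hb.of_le (by simp)).contMDiffOn fun s hs => hs
  have hdense : Dense ((ψ ∘ b) '' T)ᶜ :=
    Literature.Topology.FourManifolds.dense_compl_image_of_contMDiffOn hTo hf
      (by simpa [finrank_euclideanSpace_fin] using hkn)
  have hψW : IsOpen (ψ '' W) := ψ.isOpen_image_of_subset_source hWo inter_subset_right
  have hsub : ψ '' W ⊆ (ψ ∘ b) '' T := by
    rintro _ ⟨y, ⟨hy1, hy2⟩, rfl⟩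
    obtain ⟨s, rfl⟩ := interior_subset hy1
    exact ⟨s, hy2, rfl⟩
  obtain ⟨q, hq1, hq2⟩ := hdense.inter_open_nonempty _ hψW ⟨ψ x, x, hxW, rfl⟩
  exact hq2 (hsub hq1)

/-! ### Images of the closed piece and of the fold -/

/-- **Images of the closed piece and of the fold under the blow-down.**  If `β` is continuous on
a set `U` containing the compact set `closure V` (`M` compact), maps `V` onto the complement
of a set `B` with empty interior in the Hausdorff space `N`, and maps `frontier V` into `B`,
then `β '' closure V = univ` and `β '' frontier V = B`: the compact, hence closed, set
`β '' closure V` contains the dense set `Bᶜ = β '' V`, and `closure V = V ∪ frontier V`.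
[folklore] -/
theorem image_closure_eq_univ_of_interior_eq_empty {M N : Type*} [TopologicalSpace M]
    [CompactSpace M] [TopologicalSpace N] [T2Space N] {V U : Set M} {B : Set N} {β : M → N}
    (hVU : closure V ⊆ U) (hβ : ContinuousOn β U) (hβV : β '' V = Bᶜ)
    (hβfr : β '' frontier V ⊆ B) (hB : interior B = ∅) :
    β '' closure V = univ ∧ β '' frontier V = B := by
  have hcl : IsClosed (β '' closure V) :=
    ((isClosed_closure.isCompact).image_of_continuousOn (hβ.mono hVU)).isClosed
  have hdense : Dense Bᶜ := interior_eq_empty_iff_dense_compl.1 hB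
  have huniv : β '' closure V = univ := by
    refine eq_univ_of_univ_subset ?_
    rw [← hdense.closure_eq, ← hβV]
    exact closure_minimal (image_mono subset_closure) hcl
  refine ⟨huniv, hβfr.antisymm fun y hy => ?_⟩
  have hy' : y ∈ β '' closure V := huniv ▸ mem_univ y
  obtain ⟨x, hx, rfl⟩ := hy'
  rw [closure_eq_self_union_frontier] at hx
  rcases hx with hx | hx
  · have : β x ∈ Bᶜ := hβV ▸ mem_image_of_mem β hx
    exact (this hy).elim
  · exact mem_image_of_mem β hx

/-- **A continuous surjection from a compact set to a Hausdorff space is a quotient map.**  If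
`β` is continuous on `U ⊇ K` with `K` compact and `β '' K = univ` in the Hausdorff space `N`,
then `K.restrict β : K → N` is a closed continuous surjection (`Continuous.isClosedMap`), hence a
quotient map (`IsClosedMap.isQuotientMap`). [folklore] -/
theorem isQuotientMap_restrict_of_isCompact {M N : Type*} [TopologicalSpace M]
    [TopologicalSpace N] [T2Space N] {K U : Set M} {β : M → N} (hK : IsCompact K) (hKU : K ⊆ U)
    (hβ : ContinuousOn β U) (huniv : β '' K = univ) : IsQuotientMap (K.restrict β) := by
  haveI : CompactSpace K := isCompact_iff_compactSpace.1 hK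
  have hcont : Continuous (K.restrict β) :=
    continuousOn_iff_continuous_restrict.1 (hβ.mono hKU)
  have hsurj : Surjective (K.restrict β) := by
    intro y
    obtain ⟨x, hx, rfl⟩ := (huniv.symm ▸ mem_univ y : y ∈ β '' K)
    exact ⟨⟨x, hx⟩, rfl⟩
  exact hcont.isClosedMap.isQuotientMap hcont hsurj

/-! ### The stub -/

/-- **Sub-goal `stub_pinch_blowdownQuotient` of `stub_pinch` (line `pair-rigidity-endgame`): the
blow-down of the closed piece is a quotient map onto the target.**  With `b : S → N` a smooth
embedding of a compact surface into the `4`-manifold `N`, `β` continuous near `closure V`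
(`V` open in the compact `M`) with `β '' V = (range b)ᶜ` and `β '' frontier V ⊆ range b`:
`β '' closure V = univ`, `β '' frontier V = range b`, and `β|closure V` is a quotient map, so
that `N` is the adjunction space `closure V ∪_{β|fold} range b`.  The key input is that
`range b` has empty interior (a smooth image of a compact `2`-manifold in a `4`-manifold is
nowhere dense, Hirsch Ch. 3 §1 Prop. 1.2). [folklore] -/
theorem stub_pinch_blowdownQuotient : ∀ (M : Type) [TopologicalSpace M] [T2Space M] [CompactSpace M] [ChartedSpace (EuclideanSpace ℝ (Fin 4)) M] (N : Type) [TopologicalSpace N] [T2Space N] [ChartedSpace (EuclideanSpace ℝ (Fin 4)) N] [IsManifold (𝓡 4) ∞ N] (S : Type) [TopologicalSpace S] [CompactSpace S] [ChartedSpace (EuclideanSpace ℝ (Fin 2)) S] [IsManifold (𝓡 2) ∞ S] (V : TopologicalSpace.Opens M) (b : S → N) (β : M → N), Manifold.IsSmoothEmbedding (𝓡 2) (𝓡 4) ∞ b → (∃ U : Set M, IsOpen U ∧ closure (V : Set M) ⊆ U ∧ ContinuousOn β U) → β '' (V : Set M) = (Set.range b)ᶜ → β '' frontier (V : Set M) ⊆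 Set.range b → β '' closure (V : Set M) = Set.univ ∧ β '' frontier (V : Set M) = Set.range b ∧ Topology.IsQuotientMap ((closure (V : Set M)).restrict β) := by
  intro M _ _ _ _ N _ _ _ _ S _ _ _ _ V b β hb hβU hβV hβfr
  obtain ⟨U, _, hVU, hβ⟩ := hβU
  have hint : interior (range b) = ∅ :=
    interior_range_eq_empty_aux (by norm_num) hb.contMDiff
  obtain ⟨huniv, hfr⟩ :=
    image_closure_eq_univ_of_interior_eq_empty hVU hβ hβV hβfr hint
  exact ⟨huniv, hfr,
    isQuotientMap_restrict_of_isCompact isClosed_closure.isCompact hVU hβ huniv⟩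

end BlowdownQuotient

end Summit.SmoothPoincare4.SmoothPoincare4.Theorems.OrigamiRung.PairRigidityEndgame

end
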